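import Summits.BirchSwinnertonDyer.BirchSwinnertonDyer.Theorems.UniversalToricDescentTwinSelfDualMemberRationalInclusionAtThreeTres
import HarnessLib

/-!
# Route `UniversalToricDescent`, B column: item stmt-BirchSwinnertonDyer-24017 `TwinSelfDualMemberRationalInclusionAtThree` (K1♯†_T, route
# rev 79) BY NAME — its closers from the two-variable road TV₃†, from K1♯ᵈ†, and from the retired rev-73–78 text (old item 23310)

Cell `bsd-wall`, width seat `bsd-wall-utd-b-w1` (prover g3, 2026-08-29; explicit-unit; the prover half of step T3 of pen pss3x g7's sequence
T1 → T2 → T3, 2026-08-29T01:06:02Z / 02:36:45Z). `--supports stmt-BirchSwinnertonDyer-24017` (helper). Theorems only (no definition, no named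
fact, no `sorry`); standard axioms; default heartbeats except where the statement-sized binders need the lineage's 800k.

## What this file is

At route rev 79 (pen T2, 2026-08-29T02:36Z) the decl `Theses.UniversalToricDescent.TwinSelfDualMemberRationalInclusionAtThree` was RESTATED from
K1♯† (item 23310, retired) to **K1♯†_T** (NEW item 24017): the same text with ONE binder `¬ 3 ∣ padicValInt 3 W'.minimalDiscriminantInt →` inserted
after `Odd (NumberField.discr K) →` — the très-ramifié binder that both consumers ♭B′ 27401 / ♭B′° 22539 already carry. The kernel relations of the
B column were landed BEFORE T2 against the K1♯†_T TEXT (p682284 = `…TwinSelfDualMemberRationalInclusionAtThreeTres` §1/§2; p682999; p680907/p688397);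
this file ascribes them to the ROUTE DECL, so that item 24017 has closers concluding it BY NAME (the form the gate, the skeleton registry and the
vet read):

* §1 `twinSelfDualMemberRationalInclusionAtThree_of_twoVarCoreAtThreeDagger : TV₃† → TwinSelfDualMemberRationalInclusionAtThree` — THE closer of
  24017 from the research residue of the B column (TV₃† = the two-variable Σ-imprimitive core on the self-dual module, hypothesis `hTV` of p663826 §1†
  VERBATIM; proof = p682284 §2 `tresSelfDual_of_twoVarCoreAtThreeDagger`, i.e. exact two-variable control along `T_c ↦ 0` + (dec)† discharged on the
  très-ramifié locus). One name for the skeleton proposals v17T / v17′ of crux 22539 and for the pen's «TV₃† stays the research residue as a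
  `--supports 24017` line».
* §2 `twinSelfDualMemberRationalInclusionAtThree_of_decSelfDual : K1♯ᵈ† → TwinSelfDualMemberRationalInclusionAtThree` (K1♯ᵈ† = the rev-78 text
  with the binder (dec)† «no non-zero `Γ_{K_𝔭′}`-fixed `3`-power torsion in `A†_{g_m}`», hypothesis `hK1` of p663826 §2† VERBATIM; proof = p682284 §1).
* §3 `twinSelfDualMemberRationalInclusionAtThree_of_rev78 : K1♯† (rev-73–78 text of the decl = retired item 23310, VERBATIM) → TwinSelfDualMemberRationalInclusionAtThree`
  — monotonicity «old item ⟹ new item» as a kernel fact. (Before T2 this was p682284 §1b `tresSelfDual_of_selfDual`; after T2 that theorem reads the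
  NEW decl on both sides and is the identity, so the old ⟹ new implication quoted in item 24017's informal had no by-name witness left in the tree.)
* §4 `twinSelfDualMemberRationalInclusionAtThree_iff_tres : TwinSelfDualMemberRationalInclusionAtThree ↔ K1♯†_T-text` (`Iff.rfl`) — pins the rev-79
  text this file was checked against; if a later restatement changes the decl, §4 (and only then §1–§3) stops elaborating, which is the intended alarm.

READING (numbers, not adjectives). Nothing new is proved about any curve: §1–§3 are ascriptions of landed theorems to the restated decl. Item 24017
is closed by §1 MODULO TV₃†, for which no Eisenstein-side engine is in print at `p = 3` (Wan 2015/2020: `p ≥ 5` / squarefree level; SU14 Thm. 3.29: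
a `q ∥ N` non-split in `K`, none under the Heegner hypothesis; BCS24 §1.5 names the gap). Items closed 0; classes closed 0; BSD is proved for no curve.

References: [Castella2018Erratum] §2 (p. 2), Lemma 2.1, (2.4)–(2.5); [JetchevSkinnerWan2017] §3.4, Lemma 3.4.1, Cor. 3.4.2; [Skinner2016PacificMC]
§2.6, §3.1; [SkinnerUrban2014] Thm. 3.26, Prop. 3.23; [Wan2015]; [Castella2020JIMJ] Thm. 2.11.
-/

noncomputable section

open scoped Classical

set_option linter.dupNamespace false
set_option autoImplicit false

namespace Summit.BirchSwinnertonDyer.BirchSwinnertonDyer.Theorems.UniversalToricDescentTwinSelfDualMemberRationalInclusionAtThreeOfTwoVarCoreDagger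

open PowerSeries WeierstrassCurve NumberField IsDedekindDomain Field
  Literature.NumberTheory.EllipticCurves
  Literature.NumberTheory.EllipticCurves.ModularForms
  Literature.NumberTheory.EllipticCurves.Rank1Residual
  Literature.NumberTheory.EllipticCurves.BigGaloisRep
  Literature.NumberTheory.EllipticCurves.GreenbergSelmer
  Literature.NumberTheory.GaloisRepresentations
  Summit.BirchSwinnertonDyer.Rank1Residual.X11b
  Summit.BirchSwinnertonDyer.Rank1Residual.X11b.Halves
  Summit.BirchSwinnertonDyer.BirchSwinnertonDyer.Theorems.SchneiderFree
  Summit.BirchSwinnertonDyer.BirchSwinnertonDyer.Theorems.UniversalToricDescentTwinSelfDualMemberRationalInclusionAtThreeTres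
  Summit.BirchSwinnertonDyer.BirchSwinnertonDyer.Theses.UniversalToricDescent
  Summit.BirchSwinnertonDyer.BirchSwinnertonDyer.Theorems

/-! ### §1 Item 24017 BY NAME from the two-variable road TV₃† -/

set_option maxHeartbeats 800000 in
-- statement-sized binders over the big representation (as p662412 / p663826 / p682284); the proof is an ascription
/-- **TV₃† ⟹ `TwinSelfDualMemberRationalInclusionAtThree`** (item stmt-BirchSwinnertonDyer-24017, K1♯†_T, BY NAME): the two-variable
Σ-imprimitive core on the self-dual module `AnticyclotomicBigGaloisRep κ (D.Δ.selfDualCofreeRepOver K)` over the cyclotomic line `κ′` (hypothesis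
`hTV` of p663826 §1† VERBATIM) closes the item — p682284 §2 `tresSelfDual_of_twoVarCoreAtThreeDagger` (exact control along `T_c ↦ 0`, determinant
trick, descent of `Ch`, then (dec)† discharged by the très-ramifié binder) ascribed to the route decl at rev 79. TV₃† is the research residue of the
B column (no printed engine at `p = 3`). [cite: JetchevSkinnerWan2017, §3.4, Lemma 3.4.1 and Cor. 3.4.2 (arXiv:1512.06894 p. 14)]
[cite: Castella2018Erratum, §2 (p. 2), Lemma 2.1, (2.4) ⇒ (2.5) (p. 4)] -/
theorem twinSelfDualMemberRationalInclusionAtThree_of_twoVarCoreAtThreeDagger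
    (hTV :
    ∀ (W' : WeierstrassCurve ℚ) [W'.IsElliptic] [W'.IsGloballyMinimal] (N' : ℕ) [NeZero N']
      (K : Type) [Field K] [NumberField K] (Dt' : ModularParametrizationData W' N'),
      Mult W' 3 → W'.HasSurjectiveModNGaloisRep 3 → W'.conductorNorm ℤ = N' → IsImaginaryQuadratic K →
      SatisfiesHeegnerHypothesis N' K → Odd (NumberField.discr K) →
      ∀ (κ : ZpExtension K 3), κ.IsAnticyclotomic → ∀ (γ : absoluteGaloisGroup K) [Fact (κ.IsTopGenerator γ)]
        (𝔭 : HeightOneSpectrum (𝓞 K)), ((3 : ℕ) : 𝓞 K) ∈ 𝔭.asIdeal →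
        𝔭.asIdeal.ramificationIdx (𝓞 ℚ) = 1 → 𝔭.asIdeal.inertiaDeg (𝓞 ℚ) = 1 →
        ∀ (𝔭' : HeightOneSpectrum (𝓞 K)), ((3 : ℕ) : 𝓞 K) ∈ 𝔭'.asIdeal → 𝔭' ≠ 𝔭 →
        ∀ (ι' : PadicAlgCl 3 ≃+* ℂ), BranchInducesPrime 3 ι' 𝔭 →
        ∀ (m : ℕ), 1 ≤ m → ∀ (D : Skinner2016.HidaCongruentMember W' 3 m),
          (2 * (((3 : ℕ) : ℤ) - 1) * ((3 : ℕ) : ℤ) ^ (m - 1)) ∣ D.k - 2 →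
          SkinnerUrban2014.IsResiduallyIrreducible D.Δ →
          (∀ a : Cofree D.Δ.selfDualRep (padicCoeffField D.ι),
              (∀ σ : LocalGroup K (Sum.inl 𝔭'), (D.Δ.selfDualCofreeRepOver K) (localMap K (Sum.inl 𝔭') σ) a = a) →
              (∃ j : ℕ, (3 : ℕ) ^ j • a = 0) → a = 0) →
          (∀ x : coeffField D.g, ι' (D.ι x) = (x : ℂ)) →
        ∀ (b : padicCoeffIntegers D.ι →+* 𝓞_ℂ_[3]),
          (∀ x, ((b x : 𝓞_ℂ_[3]) : ℂ_[3]) = algebraMap (PadicAlgCl 3) ℂ_[3] (padicCoeffIntegers.toPadicAlgCl D.ι x)) →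
        ∀ (ΩK : ℂ) (Ωp : (𝓞_ℂ_[3])ˣ) (Q : PowerSeries 𝓞_ℂ_[3]), ΩK ≠ 0 →
          IsBDPLFunctionWtSigmaInt ι' 𝔭 κ γ D.g (W'.sigmaPlacesFinset 3 K) ΩK ((Ωp : 𝓞_ℂ_[3]) : ℂ_[3]) Q →
        ∀ (κ' : ZpExtension K 3) (γ' : absoluteGaloisGroup K) [Fact (κ'.IsTopGenerator γ')], κ'.IsCyclotomic →
        ∀ [TopologicalSpace (PowerSeries (padicCoeffIntegers D.ι))]
          [TopologicalSpace (PowerSeries (PowerSeries (padicCoeffIntegers D.ι)))]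
          [ContinuousSMul (PowerSeries (PowerSeries (padicCoeffIntegers D.ι)))
            (BigRepModule (PowerSeries (padicCoeffIntegers D.ι)) 3
              (BigRepModule (padicCoeffIntegers D.ι) 3 (Cofree D.Δ.selfDualRep (padicCoeffField D.ι))))],
          Module.IsTorsion (PowerSeries (PowerSeries (padicCoeffIntegers D.ι)))
              (XBig κ' (AnticyclotomicBigGaloisRep κ (D.Δ.selfDualCofreeRepOver K)) 𝔭' (↑(W'.sigmaPlacesFinset 3 K))) →
            ∃ Q₂ : PowerSeries (PowerSeries 𝓞_ℂ_[3]),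
              (∃ u : (PowerSeries 𝓞_ℂ_[3])ˣ, PowerSeries.constantCoeff Q₂ = (u : PowerSeries 𝓞_ℂ_[3]) * Q) ∧
              (XBig.charIdeal κ' (AnticyclotomicBigGaloisRep κ (D.Δ.selfDualCofreeRepOver K)) 𝔭'
                  (↑(W'.sigmaPlacesFinset 3 K))).map (PowerSeries.map (PowerSeries.map b)) ≤ Ideal.span {Q₂}) :
    TwinSelfDualMemberRationalInclusionAtThree :=
  tresSelfDual_of_twoVarCoreAtThreeDagger hTV

/-! ### §2 Item 24017 BY NAME from K1♯ᵈ† (the (dec)†-binder form) -/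

set_option maxHeartbeats 800000 in
-- statement-sized binders over the big representation; the proof is an ascription
/-- **K1♯ᵈ† ⟹ `TwinSelfDualMemberRationalInclusionAtThree`** (item 24017 BY NAME): the rev-78 text carrying the binder (dec)† «`A†_{g_m}` has no
non-zero `Γ_{K_𝔭′}`-fixed `3`-power torsion» (hypothesis `hK1` of p663826 §2† VERBATIM) closes the item — on a très-ramifié twin (dec)† holds
(`twin_dec_of_forall_not_cube`, `K_𝔭′ ≃ ℚ₃`, `BigRep.hdec_geomPoints_of_padicTorsion`, `SelfDualTwist.forall_fixed_primary_eq_zero_selfDual`):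
p682284 §1 `tresSelfDual_of_decSelfDual` ascribed to the route decl. [cite: Castella2018Erratum, §2 (p. 2), Lemma 2.1 (pp. 1–2), proof of Thm. 1.1 (a)(b)]
[cite: Skinner2016PacificMC, §2.6 (2-6-1), §3.1 (b)] -/
theorem twinSelfDualMemberRationalInclusionAtThree_of_decSelfDual
    (hK1d :
    ∀ (W' : WeierstrassCurve ℚ) [W'.IsElliptic] [W'.IsGloballyMinimal] (N' : ℕ) [NeZero N']
      (K : Type) [Field K] [NumberField K] (Dt' : ModularParametrizationData W' N'),
      Mult W' 3 → W'.HasSurjectiveModNGaloisRep 3 → W'.conductorNorm ℤ = N' → IsImaginaryQuadratic K →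
      SatisfiesHeegnerHypothesis N' K → Odd (NumberField.discr K) →
      ∀ (κ : ZpExtension K 3), κ.IsAnticyclotomic → ∀ (γ : absoluteGaloisGroup K) [Fact (κ.IsTopGenerator γ)]
        (𝔭 : HeightOneSpectrum (𝓞 K)), ((3 : ℕ) : 𝓞 K) ∈ 𝔭.asIdeal →
        𝔭.asIdeal.ramificationIdx (𝓞 ℚ) = 1 → 𝔭.asIdeal.inertiaDeg (𝓞 ℚ) = 1 →
        ∀ (𝔭' : HeightOneSpectrum (𝓞 K)), ((3 : ℕ) : 𝓞 K) ∈ 𝔭'.asIdeal → 𝔭' ≠ 𝔭 →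
        ∀ (ι' : PadicAlgCl 3 ≃+* ℂ), BranchInducesPrime 3 ι' 𝔭 →
        ∀ (m : ℕ), 1 ≤ m → ∀ (D : Skinner2016.HidaCongruentMember W' 3 m),
          (2 * (((3 : ℕ) : ℤ) - 1) * ((3 : ℕ) : ℤ) ^ (m - 1)) ∣ D.k - 2 →
          SkinnerUrban2014.IsResiduallyIrreducible D.Δ →
          (∀ a : Cofree D.Δ.selfDualRep (padicCoeffField D.ι),
              (∀ σ : LocalGroup K (Sum.inl 𝔭'), (D.Δ.selfDualCofreeRepOver K) (localMap K (Sum.inl 𝔭') σ) a = a) →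
              (∃ j : ℕ, (3 : ℕ) ^ j • a = 0) → a = 0) →
          (∀ x : coeffField D.g, ι' (D.ι x) = (x : ℂ)) →
        ∀ (b : padicCoeffIntegers D.ι →+* 𝓞_ℂ_[3]),
          (∀ x, ((b x : 𝓞_ℂ_[3]) : ℂ_[3]) = algebraMap (PadicAlgCl 3) ℂ_[3] (padicCoeffIntegers.toPadicAlgCl D.ι x)) →
        ∀ (ΩK : ℂ) (Ωp : (𝓞_ℂ_[3])ˣ) (Q : PowerSeries 𝓞_ℂ_[3]), ΩK ≠ 0 →
          IsBDPLFunctionWtSigmaInt ι' 𝔭 κ γ D.g (W'.sigmaPlacesFinset 3 K) ΩK ((Ωp : 𝓞_ℂ_[3]) : ℂ_[3]) Q →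
        ∀ [TopologicalSpace (PowerSeries (padicCoeffIntegers D.ι))]
          [ContinuousSMul (PowerSeries (padicCoeffIntegers D.ι))
            (BigRepModule (padicCoeffIntegers D.ι) 3 (Cofree D.Δ.selfDualRep (padicCoeffField D.ι)))],
          Module.IsTorsion (PowerSeries (padicCoeffIntegers D.ι))
              (XBig κ (D.Δ.selfDualCofreeRepOver K) 𝔭' (↑(W'.sigmaPlacesFinset 3 K))) →
            ∃ e : ℕ, Ideal.span {(PowerSeries.C ((3 : ℕ) : 𝓞_ℂ_[3]) : PowerSeries 𝓞_ℂ_[3]) ^ e} *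
                (XBig.charIdeal κ (D.Δ.selfDualCofreeRepOver K) 𝔭' (↑(W'.sigmaPlacesFinset 3 K))).map (PowerSeries.map b) ≤
              Ideal.span {Q}) :
    TwinSelfDualMemberRationalInclusionAtThree :=
  tresSelfDual_of_decSelfDual hK1d

/-! ### §3 Monotonicity: the retired rev-73–78 text (old item 23310, K1♯†) ⟹ the rev-79 item 24017 -/

set_option maxHeartbeats 800000 in
-- statement-sized binders over the big representation; the proof drops one hypothesis
/-- **K1♯† (rev-73–78 text of the decl = retired item stmt-BirchSwinnertonDyer-23310, VERBATIM) ⟹ `TwinSelfDualMemberRationalInclusionAtThree`**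
(rev 79, item 24017, BY NAME): the new item is the old one restricted to the très-ramifié locus, so any proof filed against the old text still
serves — the extra binder `¬ 3 ∣ v₃(Δ′_min)` is simply not used. Kernel witness of the «old ⟹ new» clause of item 24017's informal (p682284 §1b
became the identity at T2). [folklore] -/
theorem twinSelfDualMemberRationalInclusionAtThree_of_rev78
    (hK1 :
    ∀ (W' : WeierstrassCurve ℚ) [W'.IsElliptic] [W'.IsGloballyMinimal] (N' : ℕ) [NeZero N']
      (K : Type) [Field K] [NumberField K] (Dt' : ModularParametrizationData W' N'),
      Mult W' 3 → W'.HasSurjectiveModNGaloisRep 3 → W'.conductorNorm ℤ = N' → IsImaginaryQuadratic K →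
      SatisfiesHeegnerHypothesis N' K → Odd (NumberField.discr K) →
      ∀ (κ : ZpExtension K 3), κ.IsAnticyclotomic → ∀ (γ : absoluteGaloisGroup K) [Fact (κ.IsTopGenerator γ)]
        (𝔭 : HeightOneSpectrum (𝓞 K)), ((3 : ℕ) : 𝓞 K) ∈ 𝔭.asIdeal →
        𝔭.asIdeal.ramificationIdx (𝓞 ℚ) = 1 → 𝔭.asIdeal.inertiaDeg (𝓞 ℚ) = 1 →
        ∀ (𝔭' : HeightOneSpectrum (𝓞 K)), ((3 : ℕ) : 𝓞 K) ∈ 𝔭'.asIdeal → 𝔭' ≠ 𝔭 →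
        ∀ (ι' : PadicAlgCl 3 ≃+* ℂ), BranchInducesPrime 3 ι' 𝔭 →
        ∀ (m : ℕ), 1 ≤ m → ∀ (D : Skinner2016.HidaCongruentMember W' 3 m),
          (2 * (((3 : ℕ) : ℤ) - 1) * ((3 : ℕ) : ℤ) ^ (m - 1)) ∣ D.k - 2 →
          SkinnerUrban2014.IsResiduallyIrreducible D.Δ →
          (∀ x : coeffField D.g, ι' (D.ι x) = (x : ℂ)) →
        ∀ (b : padicCoeffIntegers D.ι →+* 𝓞_ℂ_[3]),
          (∀ x, ((b x : 𝓞_ℂ_[3]) : ℂ_[3]) = algebraMap (PadicAlgCl 3) ℂ_[3] (padicCoeffIntegers.toPadicAlgCl D.ι x)) →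
        ∀ (ΩK : ℂ) (Ωp : (𝓞_ℂ_[3])ˣ) (Q : PowerSeries 𝓞_ℂ_[3]), ΩK ≠ 0 →
          IsBDPLFunctionWtSigmaInt ι' 𝔭 κ γ D.g (W'.sigmaPlacesFinset 3 K) ΩK ((Ωp : 𝓞_ℂ_[3]) : ℂ_[3]) Q →
        ∀ [TopologicalSpace (PowerSeries (padicCoeffIntegers D.ι))]
          [ContinuousSMul (PowerSeries (padicCoeffIntegers D.ι))
            (BigRepModule (padicCoeffIntegers D.ι) 3 (Cofree D.Δ.selfDualRep (padicCoeffField D.ι)))],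
          Module.IsTorsion (PowerSeries (padicCoeffIntegers D.ι))
              (XBig κ (D.Δ.selfDualCofreeRepOver K) 𝔭' (↑(W'.sigmaPlacesFinset 3 K))) →
            ∃ e : ℕ, Ideal.span {(PowerSeries.C ((3 : ℕ) : 𝓞_ℂ_[3]) : PowerSeries 𝓞_ℂ_[3]) ^ e} *
                (XBig.charIdeal κ (D.Δ.selfDualCofreeRepOver K) 𝔭' (↑(W'.sigmaPlacesFinset 3 K))).map (PowerSeries.map b) ≤
              Ideal.span {Q}) :
    TwinSelfDualMemberRationalInclusionAtThree := by
  intro W' _ _ N' _ K _ _ Dt' hmult hsurj hN' hK hH hodd _ κ hκ γ _ 𝔭 h𝔭 he hf 𝔭' h𝔭' hne ι' hι'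
  exact hK1 W' N' K Dt' hmult hsurj hN' hK hH hodd κ hκ γ 𝔭 h𝔭 he hf 𝔭' h𝔭' hne ι' hι'

/-! ### §4 The text this file was checked against (rev 79) -/

set_option maxHeartbeats 800000 in
-- statement-sized binders over the big representation; the proof is `Iff.rfl`
/-- `TwinSelfDualMemberRationalInclusionAtThree` (route rev 79, item 24017) **is** K1♯†_T — the rev-78 text with the très-ramifié binder
`¬ 3 ∣ padicValInt 3 W'.minimalDiscriminantInt →` after `Odd (NumberField.discr K) →` — by `Iff.rfl`. Pins the text §1–§3 were checked against;
a later restatement of the decl makes this (deliberately) stop elaborating. [folklore] -/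
theorem twinSelfDualMemberRationalInclusionAtThree_iff_tres :
    TwinSelfDualMemberRationalInclusionAtThree ↔
    (∀ (W' : WeierstrassCurve ℚ) [W'.IsElliptic] [W'.IsGloballyMinimal] (N' : ℕ) [NeZero N']
      (K : Type) [Field K] [NumberField K] (Dt' : ModularParametrizationData W' N'),
      Mult W' 3 → W'.HasSurjectiveModNGaloisRep 3 → W'.conductorNorm ℤ = N' → IsImaginaryQuadratic K →
      SatisfiesHeegnerHypothesis N' K → Odd (NumberField.discr K) → ¬ 3 ∣ padicValInt 3 W'.minimalDiscriminantInt →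
      ∀ (κ : ZpExtension K 3), κ.IsAnticyclotomic → ∀ (γ : absoluteGaloisGroup K) [Fact (κ.IsTopGenerator γ)]
        (𝔭 : HeightOneSpectrum (𝓞 K)), ((3 : ℕ) : 𝓞 K) ∈ 𝔭.asIdeal →
        𝔭.asIdeal.ramificationIdx (𝓞 ℚ) = 1 → 𝔭.asIdeal.inertiaDeg (𝓞 ℚ) = 1 →
        ∀ (𝔭' : HeightOneSpectrum (𝓞 K)), ((3 : ℕ) : 𝓞 K) ∈ 𝔭'.asIdeal → 𝔭' ≠ 𝔭 →
        ∀ (ι' : PadicAlgCl 3 ≃+* ℂ), BranchInducesPrime 3 ι' 𝔭 →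
        ∀ (m : ℕ), 1 ≤ m → ∀ (D : Skinner2016.HidaCongruentMember W' 3 m),
          (2 * (((3 : ℕ) : ℤ) - 1) * ((3 : ℕ) : ℤ) ^ (m - 1)) ∣ D.k - 2 →
          SkinnerUrban2014.IsResiduallyIrreducible D.Δ →
          (∀ x : coeffField D.g, ι' (D.ι x) = (x : ℂ)) →
        ∀ (b : padicCoeffIntegers D.ι →+* 𝓞_ℂ_[3]),
          (∀ x, ((b x : 𝓞_ℂ_[3]) : ℂ_[3]) = algebraMap (PadicAlgCl 3) ℂ_[3] (padicCoeffIntegers.toPadicAlgCl D.ι x)) →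
        ∀ (ΩK : ℂ) (Ωp : (𝓞_ℂ_[3])ˣ) (Q : PowerSeries 𝓞_ℂ_[3]), ΩK ≠ 0 →
          IsBDPLFunctionWtSigmaInt ι' 𝔭 κ γ D.g (W'.sigmaPlacesFinset 3 K) ΩK ((Ωp : 𝓞_ℂ_[3]) : ℂ_[3]) Q →
        ∀ [TopologicalSpace (PowerSeries (padicCoeffIntegers D.ι))]
          [ContinuousSMul (PowerSeries (padicCoeffIntegers D.ι))
            (BigRepModule (padicCoeffIntegers D.ι) 3 (Cofree D.Δ.selfDualRep (padicCoeffField D.ι)))],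
          Module.IsTorsion (PowerSeries (padicCoeffIntegers D.ι))
              (XBig κ (D.Δ.selfDualCofreeRepOver K) 𝔭' (↑(W'.sigmaPlacesFinset 3 K))) →
            ∃ e : ℕ, Ideal.span {(PowerSeries.C ((3 : ℕ) : 𝓞_ℂ_[3]) : PowerSeries 𝓞_ℂ_[3]) ^ e} *
                (XBig.charIdeal κ (D.Δ.selfDualCofreeRepOver K) 𝔭' (↑(W'.sigmaPlacesFinset 3 K))).map (PowerSeries.map b) ≤
              Ideal.span {Q}) :=
  Iff.rfl

end Summit.BirchSwinnertonDyer.BirchSwinnertonDyer.Theorems.UniversalToricDescentTwinSelfDualMemberRationalInclusionAtThreeOfTwoVarCoreDagger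

end
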